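import Summits.HubbardSuperconductivity.HubbardSuperconductivity.Theses.CooperPairDMottWalk

/-!
# Route `CooperPairDMottWalk`: support `BreathingAtOneIsPure` (stmt-HubbardSuperconductivity-1179)

The breathing (plaquette) family of Hubbard Hamiltonians
`H_L(a, b, U) = hamiltonian (G \ P) a U + hamiltonian (G ⊓ P) b 0`
(`G = fermionTorusGraph 2 L`, `P = ⊤.comap plaq` the "different plaquette" relation) at
`a = b = 1` is the pure Hubbard torus `hubbardTorus 2 L 1 U`: the edge set of `G` is the disjoint
union of the intra-plaquette edges `(G \ P).Adj` and the inter-plaquette edges `(G ⊓ P).Adj`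
(`SimpleGraph.sdiff_adj`, `SimpleGraph.inf_adj`), so the two hopping sums add up to the pure one,
and the interaction term of the second summand is `(0 : ℂ) • Σ = 0`.

We prove the general edge-partition identity `hamiltonian_sdiff_add_inf` for arbitrary graphs
`G H` on any finite linearly ordered site type (with arbitrary decidability instances) and
specialise. Source: route card (arXiv:0803.0933); the identity itself is folklore bookkeeping.
No definition is introduced.
-/

set_option linter.dupNamespace false

namespace Summit.HubbardSuperconductivity.HubbardSuperconductivity.Theorems.CooperPairDMottWalk

open Literature.MathematicalPhysics.QuantumLattice
open Summit.HubbardSuperconductivity.HubbardSuperconductivity.Theses.CooperPairDMottWalk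

/-- **Edge partition of the Hubbard Hamiltonian.** For graphs `G H` on a finite site set,
`hamiltonian (G \ H) t U + hamiltonian (G ⊓ H) t 0 = hamiltonian G t U`: every edge of `G` is
either outside `H` or inside `H`, exclusively, and the second summand carries no interaction.
Holds for arbitrary `DecidableRel` instances on the three adjacency relations. [folklore] -/
theorem hamiltonian_sdiff_add_inf {Λ : Type*} [LinearOrder Λ] [Fintype Λ]
    (G H : SimpleGraph Λ) [DecidableRel G.Adj] [DecidableRel (G \ H).Adj]
    [DecidableRel (G ⊓ H).Adj] (t U : ℝ) :
    hamiltonian (G \ H) t U + hamiltonian (G ⊓ H) t 0 = hamiltonian G t U := by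
  have key : ∀ (x y : Λ) (A : Matrix (Finset (Orb Λ)) (Finset (Orb Λ)) ℂ),
      ((if (G \ H).Adj x y then A else 0) + if (G ⊓ H).Adj x y then A else 0) =
        if G.Adj x y then A else 0 := by
    intro x y A
    by_cases h1 : G.Adj x y
    · by_cases h2 : H.Adj x y
      · rw [if_neg (fun h => ((SimpleGraph.sdiff_adj G H x y).1 h).2 h2),
          if_pos ((SimpleGraph.inf_adj G H x y).2 ⟨h1, h2⟩), if_pos h1, zero_add]
      · rw [if_pos ((SimpleGraph.sdiff_adj G H x y).2 ⟨h1, h2⟩),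
          if_neg (fun h => h2 ((SimpleGraph.inf_adj G H x y).1 h).2), if_pos h1, add_zero]
    · rw [if_neg (fun h => h1 ((SimpleGraph.sdiff_adj G H x y).1 h).1),
        if_neg (fun h => h1 ((SimpleGraph.inf_adj G H x y).1 h).1), if_neg h1, add_zero]
  have hS : (∑ x : Λ, ∑ y : Λ, ∑ σ : Fin 2,
        if (G \ H).Adj x y then creation (orb x σ) * annihilation (orb y σ) else 0) +
      (∑ x : Λ, ∑ y : Λ, ∑ σ : Fin 2,
        if (G ⊓ H).Adj x y then creation (orb x σ) * annihilation (orb y σ) else 0) =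
      ∑ x : Λ, ∑ y : Λ, ∑ σ : Fin 2,
        (if G.Adj x y then creation (orb x σ) * annihilation (orb y σ) else
          (0 : Matrix (Finset (Orb Λ)) (Finset (Orb Λ)) ℂ)) := by
    rw [← Finset.sum_add_distrib]
    refine Finset.sum_congr rfl fun x _ => ?_
    rw [← Finset.sum_add_distrib]
    refine Finset.sum_congr rfl fun y _ => ?_
    rw [← Finset.sum_add_distrib]
    exact Finset.sum_congr rfl fun σ _ => key x y _
  unfold hamiltonian
  rw [← hS, Complex.ofReal_zero, zero_smul, add_zero, smul_add]
  abel

/-- **`BreathingAtOneIsPure` holds** (route `CooperPairDMottWalk`, support item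
`stmt-HubbardSuperconductivity-1179`): the breathing family at `(a, b) = (1, 1)` is the pure
Hubbard torus, `hamiltonian (G \ P) 1 U + hamiltonian (G ⊓ P) 1 0 = hubbardTorus 2 L 1 U`, by the
edge partition `hamiltonian_sdiff_add_inf` (`hubbardTorus 2 L 1 U = hamiltonian G 1 U` by
definition). [folklore] -/
theorem breathingAtOneIsPure_proof : BreathingAtOneIsPure := by
  intro L U
  exact hamiltonian_sdiff_add_inf _ _ 1 U

end Summit.HubbardSuperconductivity.HubbardSuperconductivity.Theorems.CooperPairDMottWalk
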